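import Summits.CriticalPhenomena.PercolationContinuityZ3.Theorems.PercNearOneGluingNoHeavyLowerTailTwoCopyAtomicBridge

/-!
# The abstract atomic-step count for the `B8` kernel is FALSE (ground set of size 6)

Support file for crux `stmt-CriticalPhenomena-4575` (master-family programme, two-link deficit rows `W0 ⊂ B8` of
`prim-l12-p1` gens 11/12), seat `prim-l12-p6` gen 20; memo
`run/shared/lean/prim/prim-l12/FROM-prim-l12-p6-g20-EDGEGOOD-B8-REFUTED.md`.  Pure finite combinatorics (kernel `decide`);
no named facts, no sorries, no definitions.

`…TwoCopyAtomicBridge` (`TwoCopyMono.b8_of_atomicCount`, gen 19) reduced the row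
`B8 : cell(ab|c|y)·cell(a|b|cy) ≤ cell(ab|cy)·[cell ∅ + cell(ab|c|y) + cell(a|b|cy)] + cell ∅·ΣK + [cell(a|bcy)+cell(acy|b)]·[cell(aby|c)+cell(abc|y)]`
on every finite weighted graph to `prim-l12-p1` g11's CONJECTURE EdgeGood-B8: the signed antipodal count of the `B8` kernel is
`≥ 0` for EVERY monotone atomic-step ("edge-like") cell map `ι : Finset γ → Fin 15` on EVERY finite type `γ` (verified
exhaustively for `|γ| ≤ 5`: 46 / 241 / 2 883 / 139 495 / 106 003 702 maps).  Here we record that the hypothesis is FALSE at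
`|γ| = 6` (found by SAT — kissat, 6 s — and checked independently; kit job `j166426`, evidence on the item):

* the witness `Finset (Fin 6) → Fin 15` (written inline in the proof; no definitions in this file): the `a–b` link is the 2-of-3
  MAJORITY of the coordinates `{0,1,2}`, the `c–y` link the 2-of-3 majority of `{3,4,5}`, no cross connection anywhere except the
  super-join `abcy` at the top set `univ`; it is monotone for the Boolean cell order `ple` and has atomic one-coordinate steps (each
  step changes at most one of the two majorities; the last step `ab|cy → abcy` merges two blocks); its signed `B8` count is `−1`
  (16 bad antipodal pairs `(ab|c|y, a|b|cy)` against 15 good pairs `(ab|cy, ∅)`; the top pair `(abcy, ∅)` is not credited by `B8`);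
* `atomicCount_majority_constraint` (appended) — the same witness as a LINEAR CONSTRAINT on any abstractly valid kernel `κ`:
  `0 ≤ 16·(κ₆₁+κ₁₆+κ₁₁,₀+κ₀,₁₁) − (κ₁₁,₀+κ₀,₁₁) + (κ₁₄,₀+κ₀,₁₄)` — every unit-coefficient deficit row needs the `q·T` credit;
* `not_atomicCount_B8` — hence the hypothesis of `b8_of_atomicCount` is unsatisfiable: that conditional theorem is vacuous, and a
  proof of `B8 ∀n` must use more than monotonicity + atomic steps (graph structure), exactly as recorded for `W0` at `|γ| = 5`.
  The same witness family (two `m`-of-`(2m−1)` majorities + top super-join) shows that NO kernel with the deficit normalisation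
  `κ(ab|c|y,a|b|cy) = −1, κ(ab|cy,∅) = +1` has a nonnegative abstract count unless it credits the pair `(abcy, ∅)` with weight `≥ 1`
  (memo §2) — i.e. abstract monotone/atomic counting cannot go beyond the two-sided BHK / `Q44b` bound `Δ* ≤ cell ∅ · cell(abcy)`.
The 2-of-3 majority link is not realisable by a multigraph, so `B8` on graphs (comb-positive through `K₇`, `prim-l12-p1` g11) is
not contradicted.
-/

namespace Summit.CriticalPhenomena.PercolationContinuityZ3.Theorems

namespace TwoCopyMono

open Finset FourPointAtoms

/-- **EdgeGood-B8 is false**: the abstract atomic-step count hypothesis of `b8_of_atomicCount` fails on the type `Fin 6`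
for the explicit "two 2-of-3 majorities + top super-join" map (all three finite checks by kernel `decide`).  So `B8 ∀n` is
NOT an abstract monotone/atomic counting theorem; any proof needs graph structure. [this work] -/
theorem not_atomicCount_B8 :
    ¬ (∀ (γ : Type) [Fintype γ] [DecidableEq γ] (ι : Finset γ → Fin 15),
      (∀ S T : Finset γ, S ⊆ T → ple (ι S) (ι T) = true) →
      (∀ (T : Finset γ) (g : γ), ι (insert g T) = ι T ∨ ∃ x₀ y₀ : Fin 4, pp (ι (insert g T)) =
        fun i j => (pp (ι T) i j || (pp (ι T) i x₀ && pp (ι T) y₀ j) || (pp (ι T) i y₀ && pp (ι T) x₀ j))) →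
        0 ≤ ∑ T : Finset γ, ((if ι T = 11 ∧ ι Tᶜ = 0 then (1 : ℤ) else 0) + (if ι T = 11 ∧ ι Tᶜ = 6 then (1 : ℤ) else 0) +
          (if ι T = 11 ∧ ι Tᶜ = 1 then (1 : ℤ) else 0) + (if ι T = 0 ∧ ι Tᶜ = 7 then (1 : ℤ) else 0) + (if ι T = 0 ∧ ι Tᶜ = 10 then (1 : ℤ) else 0) +
          (if ι T = 0 ∧ ι Tᶜ = 12 then (1 : ℤ) else 0) + (if ι T = 0 ∧ ι Tᶜ = 13 then (1 : ℤ) else 0) + (if ι T = 7 ∧ ι Tᶜ = 12 then (1 : ℤ) else 0) +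
          (if ι T = 7 ∧ ι Tᶜ = 13 then (1 : ℤ) else 0) + (if ι T = 10 ∧ ι Tᶜ = 12 then (1 : ℤ) else 0) + (if ι T = 10 ∧ ι Tᶜ = 13 then (1 : ℤ) else 0) -
          (if ι T = 6 ∧ ι Tᶜ = 1 then (1 : ℤ) else 0))) := by
  intro h
  -- the witness: `a–b` link = 2-of-3 majority of `{0,1,2}`, `c–y` link = 2-of-3 majority of `{3,4,5}`, super-join at `univ`
  have h6 := h (Fin 6)
    (fun T => if T = univ then 14 else
      if 2 ≤ (T ∩ {0, 1, 2}).card then (if 2 ≤ (T ∩ {3, 4, 5}).card then 11 else 6)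
      else (if 2 ≤ (T ∩ {3, 4, 5}).card then 1 else 0))
    (by decide +kernel) (by decide +kernel)
  exact absurd h6 (by decide +kernel)

/-- **The majority-witness constraint on abstractly valid kernels** (the `|γ| = 6` instance of the no-go family of memo §2): if a kernel
`κ` has a nonnegative abstract count on EVERY monotone atomic-step cell map, then — evaluated on the witness of `not_atomicCount_B8`,
whose 64 antipodal pairs read `(ab|c|y; a|b|cy)` ×16, `(a|b|cy; ab|c|y)` ×16, `(ab|cy; ∅)` ×15, `(∅; ab|cy)` ×15, `(abcy; ∅)` ×1, `(∅; abcy)` ×1 —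
`0 ≤ 16·(κ(6,1)+κ(1,6)+κ(11,0)+κ(0,11)) − (κ(11,0)+κ(0,11)) + (κ(14,0)+κ(0,14))`.  For every 'deficit row'
`Sab·Scy ≤ P11·q + …` with unit coefficients the first bracket vanishes, so the row needs the `q·T` credit `κ(14,0)+κ(0,14) ≥ 1`: none of
`W0, W0*, V13, V15, V12, B8, W4, W10, W11, B6, B7, CUT1` (`prim-l12-p1` gens 11/12) is an abstract counting theorem. [this work] -/
theorem atomicCount_majority_constraint (κ : Fin 15 → Fin 15 → ℤ)
    (h : ∀ (γ : Type) [Fintype γ] [DecidableEq γ] (ι : Finset γ → Fin 15),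
      (∀ S T : Finset γ, S ⊆ T → ple (ι S) (ι T) = true) →
      (∀ (T : Finset γ) (g : γ), ι (insert g T) = ι T ∨ ∃ x₀ y₀ : Fin 4, pp (ι (insert g T)) =
        fun i j => (pp (ι T) i j || (pp (ι T) i x₀ && pp (ι T) y₀ j) || (pp (ι T) i y₀ && pp (ι T) x₀ j))) →
        0 ≤ ∑ T : Finset γ, κ (ι T) (ι Tᶜ)) :
    0 ≤ 16 * (κ 6 1 + κ 1 6 + κ 11 0 + κ 0 11) - (κ 11 0 + κ 0 11) + (κ 14 0 + κ 0 14) := by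
  classical
  -- the witness (same map as in `not_atomicCount_B8`)
  set ι : Finset (Fin 6) → Fin 15 := fun T => if T = univ then 14 else
      if 2 ≤ (T ∩ {0, 1, 2}).card then (if 2 ≤ (T ∩ {3, 4, 5}).card then 11 else 6)
      else (if 2 ≤ (T ∩ {3, 4, 5}).card then 1 else 0) with hι
  have hmono : ∀ S T : Finset (Fin 6), S ⊆ T → ple (ι S) (ι T) = true := by rw [hι]; decide +kernel
  have hatom : ∀ (T : Finset (Fin 6)) (g : Fin 6), ι (insert g T) = ι T ∨ ∃ x₀ y₀ : Fin 4, pp (ι (insert g T)) =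
      fun i j => (pp (ι T) i j || (pp (ι T) i x₀ && pp (ι T) y₀ j) || (pp (ι T) i y₀ && pp (ι T) x₀ j)) := by
    rw [hι]; decide +kernel
  have h6 := h (Fin 6) ι hmono hatom
  -- classification of the 64 antipodal pairs
  have hc : ∀ T : Finset (Fin 6), (ι T = 6 ∧ ι Tᶜ = 1) ∨ (ι T = 1 ∧ ι Tᶜ = 6) ∨ (ι T = 11 ∧ ι Tᶜ = 0) ∨
      (ι T = 0 ∧ ι Tᶜ = 11) ∨ (ι T = 14 ∧ ι Tᶜ = 0) ∨ (ι T = 0 ∧ ι Tᶜ = 14) := by rw [hι]; decide +kernel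
  have hsplit : ∀ T : Finset (Fin 6), κ (ι T) (ι Tᶜ) =
      κ 6 1 * (if ι T = 6 ∧ ι Tᶜ = 1 then 1 else 0) + κ 1 6 * (if ι T = 1 ∧ ι Tᶜ = 6 then 1 else 0) +
      κ 11 0 * (if ι T = 11 ∧ ι Tᶜ = 0 then 1 else 0) + κ 0 11 * (if ι T = 0 ∧ ι Tᶜ = 11 then 1 else 0) +
      κ 14 0 * (if ι T = 14 ∧ ι Tᶜ = 0 then 1 else 0) + κ 0 14 * (if ι T = 0 ∧ ι Tᶜ = 14 then 1 else 0) := by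
    intro T
    rcases hc T with ⟨h1, h2⟩ | ⟨h1, h2⟩ | ⟨h1, h2⟩ | ⟨h1, h2⟩ | ⟨h1, h2⟩ | ⟨h1, h2⟩ <;> simp [h1, h2]
  have hcount : (∑ T : Finset (Fin 6), (if ι T = 6 ∧ ι Tᶜ = 1 then (1 : ℤ) else 0)) = 16 ∧
      (∑ T : Finset (Fin 6), (if ι T = 1 ∧ ι Tᶜ = 6 then (1 : ℤ) else 0)) = 16 ∧
      (∑ T : Finset (Fin 6), (if ι T = 11 ∧ ι Tᶜ = 0 then (1 : ℤ) else 0)) = 15 ∧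
      (∑ T : Finset (Fin 6), (if ι T = 0 ∧ ι Tᶜ = 11 then (1 : ℤ) else 0)) = 15 ∧
      (∑ T : Finset (Fin 6), (if ι T = 14 ∧ ι Tᶜ = 0 then (1 : ℤ) else 0)) = 1 ∧
      (∑ T : Finset (Fin 6), (if ι T = 0 ∧ ι Tᶜ = 14 then (1 : ℤ) else 0)) = 1 := by
    rw [hι]; refine ⟨?_, ?_, ?_, ?_, ?_, ?_⟩ <;> decide +kernel
  obtain ⟨c1, c2, c3, c4, c5, c6⟩ := hcount
  rw [Finset.sum_congr rfl (fun T _ => hsplit T)] at h6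
  simp only [Finset.sum_add_distrib, ← Finset.mul_sum] at h6
  rw [c1, c2, c3, c4, c5, c6] at h6
  linarith

end TwoCopyMono

end Summit.CriticalPhenomena.PercolationContinuityZ3.Theorems
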